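import Mathlib
import HarnessLib
import Literature.Analysis.FluidPDE.SelfSimilar
import Literature.Analysis.FluidPDE.LocalTypeI
import Literature.Analysis.FluidPDE.VectorCalculus
import Literature.Analysis.FluidPDE.CurlFreeLiouville
import Literature.Analysis.FluidPDE.TaoEnstrophyLocalisationProofs
import Literature.Analysis.FluidPDE.TypeIAncientMild
import Literature.Analysis.UnboundedOperators.HeatKernel
import Summits.NavierStokesRegularity.NavierStokesRegularity.Theorems.LocalSineTubeDoorProfileAlignedWindowRigidityAncient
import Summits.NavierStokesRegularity.NavierStokesRegularity.Theorems.LocalSineTubeDoorProfileAlignedWindowRigidity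
import Summits.NavierStokesRegularity.NavierStokesRegularity.Theorems.PoloidalWindowDoorPoloidalWindowRigidityWindow
import Summits.NavierStokesRegularity.NavierStokesRegularity.Theorems.PoloidalWindowDoorPoloidalWindowRigidityFlat

/-!
# Route `PoloidalWindowDoor` (staged, nsreg-p1), crux `PoloidalWindowRigidity` — the two DEGENERATE strata of the open
# stub `stub_nonflatLiouville`: irrotational profiles (R8-h) and vertically rigid profiles (R8-f)

Cell ns-regularity-ideate, seat p6 (route-directed support; land `--supports <PoloidalWindowRigidity item>` once the
route is born). Ports of the cell's kernel rungs (nsreg-p1 ROUND-8 Addendum A, Sketch8A `poloidalRigidity_rung_irrotational`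
L5724 and `sliceInvariant_of_vertRigid` / `poloidalRigidity_rung_vertRigid` L5581/L5686) over the class hypotheses of the
K2 skeleton (no cell structures):

* `eq_zero_of_irrotational` / `nonflatLiouville_of_irrotational` — (R8-h) a profile of the route's Type-I class whose
  slices are irrotational vanishes identically (curl-free + divergence-free + bounded ⇒ constant slices, tree
  `eq_of_curl_eq_zero_of_isDivFree_of_bounded`; the Type-I gauge kills constants, `IsTypeIAncientMild.eq_zero_of_slice_const`);
  so the content of K2's residue lives on ROTATIONAL profiles;
* `fderiv_fderiv_apply_coord_eq_zero`, `translate_eq_of_vertRigid` — the vector-calculus core of (R8-f): a `C²` bounded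
  divergence-free field whose horizontal velocity is rigid in the vertical direction (`(∂₂V)₀ ≡ 0 ≡ (∂₂V)₁`) is
  invariant under vertical translations (`div V = 0` makes `V₂` affine along vertical lines, boundedness makes it constant);
* `eq_zero_of_vertRigid` / `nonflatLiouville_of_vertRigid` — (R8-f) a profile of the class with `∂₂ v_h ≡ 0` on every
  slice vanishes identically (vertical slice invariance + the ancient planar Liouville theorem (N₁) with the Type-I rate,
  tree `…LocalSineTubeDoorProfileAlignedWindowRigidity.eq_zero_of_translate_eq`); so the residue lives on profiles with
  `∂₂ v_h ≢ 0`.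

WHAT THIS IS NOT: not a claim about Navier–Stokes regularity and not the open stub — two settled degenerate strata of it,
for a STAGED door route (bears_on LADDER-NS N0, rung N0-LocalTubeDoorPoloidal).
-/

noncomputable section

-- the summit and its single sub-problem share the name (CONVENTIONS §1), as in every Theorems file
set_option linter.dupNamespace false

namespace Summit.NavierStokesRegularity.NavierStokesRegularity.Theorems.PoloidalWindowDoorPoloidalWindowRigidityDegenerate

open MeasureTheory Set Function Filter Topology TopologicalSpace Metric
open scoped RealInnerProductSpace InnerProductSpace
open Literature.Analysis Literature.Analysis.FluidPDE
open Summit.NavierStokesRegularity.NavierStokesRegularity.Theorems.LocalSineTubeDoorProfileAlignedWindowRigidityAncient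
open Summit.NavierStokesRegularity.NavierStokesRegularity.Theorems.LocalSineTubeDoorProfileAlignedWindowRigidity
open Summit.NavierStokesRegularity.NavierStokesRegularity.Theorems.PoloidalWindowDoorPoloidalWindowRigidityWindow
open Summit.NavierStokesRegularity.NavierStokesRegularity.Theorems.PoloidalWindowDoorPoloidalWindowRigidityFlat

variable {C : ℝ} {v : ℝ → EuclideanSpace ℝ (Fin 3) → EuclideanSpace ℝ (Fin 3)}

/-! ### (R8-h) the irrotational stratum -/

/-- **(R8-h) Irrotational profiles of the class are trivial.** If every slice of a profile of the route's Type-I class is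
curl-free, then (being divergence-free and bounded) every slice is constant (harmonic Liouville, tree
`eq_of_curl_eq_zero_of_isDivFree_of_bounded`) and the Type-I gauge forces `v ≡ 0`
(`IsTypeIAncientMild.eq_zero_of_slice_const`) (port of nsreg-p1 Sketch8A `poloidalRigidity_rung_irrotational`). -/
theorem eq_zero_of_irrotational (hrate : HasTypeITimeDecay C v)
    (hcont : ContinuousOn (uncurry v) (Iio (0 : ℝ) ×ˢ univ))
    (hmild : ∀ s t : ℝ, s < t → t < 0 → ∀ x,
      v t x = UnboundedOperators.heatExtension (v s) (t - s) x - oseenDuhamel 1 s v v t x)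
    (hdiv : ∀ t < 0, VectorCalculus.IsDivFree (v t))
    (hirr : ∀ s < 0, ∀ y, curl (v s) y = 0) : ∀ t < 0, ∀ x, v t x = 0 := by
  have hA : IsTypeIAncientMild C v := isTypeIAncientMild_of_class hrate hcont hmild hdiv
  have hconst : ∀ s < 0, ∀ y, v s y = v s 0 := by
    intro s hs y
    have hC2 : ContDiff ℝ 2 (v s) := (analyticOnNhd_slice hcont (bdd_of_hasTypeITimeDecay hrate) hmild hs).contDiff
    exact eq_of_curl_eq_zero_of_isDivFree_of_bounded hC2 (hirr s hs) (hdiv s hs)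
      (fun y => hrate s hs y) y 0
  exact fun t ht y => hA.eq_zero_of_slice_const (b := fun t => v t 0) hconst ht y

/-- **(R8-h) The irrotational sub-stratum of the open stub is settled**: an irrotational profile of the class is not
backward-singular (it vanishes). -/
theorem nonflatLiouville_of_irrotational (hrate : HasTypeITimeDecay C v)
    (hcont : ContinuousOn (uncurry v) (Iio (0 : ℝ) ×ˢ univ))
    (hmild : ∀ s t : ℝ, s < t → t < 0 → ∀ x,
      v t x = UnboundedOperators.heatExtension (v s) (t - s) x - oseenDuhamel 1 s v v t x)
    (hdiv : ∀ t < 0, VectorCalculus.IsDivFree (v t))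
    (hirr : ∀ s < 0, ∀ y, curl (v s) y = 0) : ¬ IsBackwardSingularPoint v 0 :=
  not_backwardSingular_of_zero (eq_zero_of_irrotational hrate hcont hmild hdiv hirr)

/-! ### (R8-f) the vertically rigid stratum -/

/-- Mixed second derivatives along a direction `e` in which a component is rigid vanish: if `(∂ₑV)ᵢ ≡ 0` then
`∂ₑ(∂ₖV)ᵢ ≡ 0` for every `k` (symmetry of second derivatives; port of nsreg-p1 Sketch8A). -/
theorem fderiv_fderiv_apply_coord_eq_zero {V : EuclideanSpace ℝ (Fin 3) → EuclideanSpace ℝ (Fin 3)}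
    (hV : ContDiff ℝ 2 V) {e : EuclideanSpace ℝ (Fin 3)} {i : Fin 3} (hi : ∀ x, fderiv ℝ V x e i = 0)
    (k z : EuclideanSpace ℝ (Fin 3)) : fderiv ℝ (fun x => fderiv ℝ V x k i) z e = 0 := by
  have hF1 : ∀ k' : EuclideanSpace ℝ (Fin 3), ContDiff ℝ 1 (fun x => fderiv ℝ V x k') := fun k' =>
    (hV.fderiv_right (m := 1) (by norm_cast)).clm_apply contDiff_const
  have hFd : ∀ k' : EuclideanSpace ℝ (Fin 3), Differentiable ℝ (fun x => fderiv ℝ V x k') := fun k' =>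
    (hF1 k').differentiable one_ne_zero
  -- `∂ₑ(∂ₖV)ᵢ = (∂ₑ ∂ₖ V)ᵢ = (∂ₖ ∂ₑ V)ᵢ = ∂ₖ (∂ₑV)ᵢ = 0`
  have h1 : fderiv ℝ (fun x => fderiv ℝ V x k i) z e = fderiv ℝ (fun x => fderiv ℝ V x k) z e i := by
    change fderiv ℝ (fun x => (fun x => fderiv ℝ V x k) x i) z e = _
    rw [← PoloidalWindowDoorPoloidalWindowRigidityFlat.fderiv_apply_coord (hFd k z) e i]
  have h2 : fderiv ℝ (fun x => fderiv ℝ V x k) z e = fderiv ℝ (fun x => fderiv ℝ V x e) z k := by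
    rw [fderiv_fderiv_apply_eq hV z k, fderiv_fderiv_apply_eq hV z e]
    exact (hV.contDiffAt.isSymmSndFDerivAt (n := 2) (by simp)) k e
  have h3 : fderiv ℝ (fun x => fderiv ℝ V x e) z k i = fderiv ℝ (fun x => fderiv ℝ V x e i) z k := by
    rw [PoloidalWindowDoorPoloidalWindowRigidityFlat.fderiv_apply_coord (hFd e z) k i]
  have h4 : (fun x => fderiv ℝ V x e i) = fun _ => (0 : ℝ) := funext hi
  rw [h1, h2, h3, h4]
  simp

/-- **The vector-calculus core of (R8-f).** `V ∈ C²` bounded and divergence-free with `(∂₂V)₀ ≡ 0 ≡ (∂₂V)₁`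
(horizontal velocity rigid in the vertical direction) ⟹ `V` is invariant along `e₂`: `div V = 0` gives
`(∂₂V)₂ = −(∂₀V)₀ − (∂₁V)₁`, whose `e₂`-derivative vanishes by the previous lemma, so `V₂` is affine — hence, being
bounded, constant — along vertical lines (port of nsreg-p1 Sketch8A `sliceInvariant_of_vertRigid`). -/
theorem translate_eq_of_vertRigid {V : EuclideanSpace ℝ (Fin 3) → EuclideanSpace ℝ (Fin 3)} (hV : ContDiff ℝ 2 V)
    (hdiv : VectorCalculus.IsDivFree V) {M : ℝ} (hM : ∀ y, ‖V y‖ ≤ M)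
    (h0 : ∀ y, fderiv ℝ V y (EuclideanSpace.single 2 1) 0 = 0)
    (h1 : ∀ y, fderiv ℝ V y (EuclideanSpace.single 2 1) 1 = 0) (y : EuclideanSpace ℝ (Fin 3)) (l : ℝ) :
    V (y + l • (EuclideanSpace.single 2 1 : EuclideanSpace ℝ (Fin 3))) = V y := by
  have hV1 : Differentiable ℝ V := hV.differentiable (by norm_num)
  have hFd : ∀ k' : EuclideanSpace ℝ (Fin 3), Differentiable ℝ (fun x => fderiv ℝ V x k') := fun k' =>
    ((hV.fderiv_right (m := 1) (by norm_cast)).clm_apply contDiff_const).differentiable one_ne_zero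
  obtain ⟨e, he⟩ : ∃ e : EuclideanSpace ℝ (Fin 3), EuclideanSpace.single 2 1 = e := ⟨_, rfl⟩
  rw [he]
  have he0 : e 0 = 0 := by rw [← he]; simp
  have he1 : e 1 = 0 := by rw [← he]; simp
  have he2 : e 2 = 1 := by rw [← he]; simp
  have h0' : ∀ x, fderiv ℝ V x e 0 = 0 := fun x => by rw [← he]; exact h0 x
  have h1' : ∀ x, fderiv ℝ V x e 1 = 0 := fun x => by rw [← he]; exact h1 x
  -- (1) `(∂ₑV)₂ = −(∂₀V)₀ − (∂₁V)₁` everywhere (div V = 0)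
  have hfun : (fun x => fderiv ℝ V x e 2) = fun x =>
      -(fderiv ℝ V x (EuclideanSpace.single 0 1) 0 + fderiv ℝ V x (EuclideanSpace.single 1 1) 1) := by
    funext x
    have hd := hdiv x
    rw [divergence_eq_sum_inner_fderiv (EuclideanSpace.basisFun (Fin 3) ℝ)] at hd
    simp only [Fin.sum_univ_three, EuclideanSpace.basisFun_apply, EuclideanSpace.inner_single_left,
      map_one, one_mul] at hd
    rw [← he]
    linarith
  -- (2) hence `∂ₑ (∂ₑV)₂ ≡ 0`
  have hw : ∀ z, fderiv ℝ (fun x => fderiv ℝ V x e 2) z e = 0 := fun z => by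
    have hdA : ∀ (k : EuclideanSpace ℝ (Fin 3)) (i : Fin 3), DifferentiableAt ℝ (fun x => fderiv ℝ V x k i) z :=
      fun k i => by
        have : (fun x => fderiv ℝ V x k i) = (EuclideanSpace.proj (𝕜 := ℝ) i : EuclideanSpace ℝ (Fin 3) →L[ℝ] ℝ) ∘
            fun x => fderiv ℝ V x k := rfl
        rw [this]
        exact ((EuclideanSpace.proj (𝕜 := ℝ) i : EuclideanSpace ℝ (Fin 3) →L[ℝ] ℝ).differentiableAt).comp z (hFd k z)
    have hH : HasFDerivAt (fun x => fderiv ℝ V x e 2)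
        (-(fderiv ℝ (fun x => fderiv ℝ V x (EuclideanSpace.single 0 1) 0) z +
          fderiv ℝ (fun x => fderiv ℝ V x (EuclideanSpace.single 1 1) 1) z)) z := by
      rw [hfun]
      exact ((hdA _ 0).hasFDerivAt.add (hdA _ 1).hasFDerivAt).neg
    rw [hH.fderiv]
    simp [fderiv_fderiv_apply_coord_eq_zero hV h0', fderiv_fderiv_apply_coord_eq_zero hV h1']
  -- (3) so `(∂ₑV)₂` is constant along the line `y + t e`
  have hwc : ∀ t : ℝ, fderiv ℝ V (y + t • e) e 2 = fderiv ℝ V y e 2 := fun t => by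
    have hg : ∀ t : ℝ, HasDerivAt (fun t : ℝ => fderiv ℝ V (y + t • e) e 2) 0 t := fun t => by
      have hline : HasDerivAt (fun t : ℝ => y + t • e) e t := by
        simpa using ((hasDerivAt_id t).smul_const e).const_add y
      have hwd : DifferentiableAt ℝ (fun x => fderiv ℝ V x e 2) (y + t • e) := by
        have : (fun x => fderiv ℝ V x e 2) =
            (EuclideanSpace.proj (𝕜 := ℝ) (2 : Fin 3) : EuclideanSpace ℝ (Fin 3) →L[ℝ] ℝ) ∘ fun x => fderiv ℝ V x e := rfl
        rw [this]
        exact ((EuclideanSpace.proj (𝕜 := ℝ) (2 : Fin 3) : EuclideanSpace ℝ (Fin 3) →L[ℝ] ℝ).differentiableAt).comp _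
          (hFd e _)
      have h := hwd.hasFDerivAt.comp_hasDerivAt t hline
      rw [hw] at h
      exact h
    have := is_const_of_deriv_eq_zero (f := fun t : ℝ => fderiv ℝ V (y + t • e) e 2)
      (fun t => (hg t).differentiableAt) (fun t => (hg t).deriv) t 0
    simpa using this
  -- (4) the full derivative along the line is the constant vector `c = (∂ₑV)₂(y) • e`
  obtain ⟨c, hc⟩ : ∃ c : EuclideanSpace ℝ (Fin 3), (fderiv ℝ V y e 2) • e = c := ⟨_, rfl⟩
  have hconst : ∀ t : ℝ, fderiv ℝ V (y + t • e) e = c := fun t => by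
    rw [← hc]
    ext i
    fin_cases i
    · simp [h0', he0]
    · simp [h1', he1]
    · simp [hwc t, he2]
  -- (5) `V (y + l e) = V y + l • c`, and boundedness forces `c = 0`
  have hgd : ∀ l, HasDerivAt (fun l : ℝ => V (y + l • e)) c l := fun l => by
    have hline : HasDerivAt (fun l : ℝ => y + l • e) e l := by
      simpa using ((hasDerivAt_id l).smul_const e).const_add y
    have h := (hV1 (y + l • e)).hasFDerivAt.comp_hasDerivAt l hline
    rw [hconst l] at h
    exact h
  have hd : ∀ l, HasDerivAt (fun l : ℝ => V (y + l • e) - l • c) 0 l := fun l => by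
    have h := (hgd l).sub ((hasDerivAt_id' l).smul_const c)
    simp only [one_smul, sub_self] at h
    exact h
  have hh : ∀ l, V (y + l • e) - l • c = V (y + (0 : ℝ) • e) - (0 : ℝ) • c := fun l =>
    is_const_of_deriv_eq_zero (f := fun l : ℝ => V (y + l • e) - l • c)
      (fun l => (hd l).differentiableAt) (fun l => (hd l).deriv) l 0
  have hlin : ∀ l, V (y + l • e) = V y + l • c := fun l => by
    have := hh l
    simp only [zero_smul, sub_zero, add_zero] at this
    rw [← this]; abel
  have hc0 : c = 0 := by
    by_contra hne
    have hcpos : 0 < ‖c‖ := norm_pos_iff.2 hne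
    obtain ⟨l₀, hl⟩ : ∃ l₀ : ℝ, l₀ = (2 * M + 1) / ‖c‖ := ⟨_, rfl⟩
    have hM0 : 0 ≤ M := (norm_nonneg _).trans (hM y)
    have hl0 : 0 ≤ l₀ := by rw [hl]; positivity
    have h1 : ‖l₀ • c‖ ≤ 2 * M := by
      have : l₀ • c = V (y + l₀ • e) - V y := by rw [hlin l₀]; abel
      rw [this]
      exact (norm_sub_le _ _).trans (by linarith [hM (y + l₀ • e), hM y])
    have h2 : ‖l₀ • c‖ = 2 * M + 1 := by
      rw [norm_smul, Real.norm_eq_abs, abs_of_nonneg hl0, hl, div_mul_cancel₀ _ hcpos.ne']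
    linarith
  rw [hlin l, hc0, smul_zero, add_zero]

/-- **(R8-f) Vertically rigid profiles of the class are trivial.** If on every slice the horizontal velocity does not
vary in the vertical direction (`(∂₂v)₀ ≡ 0 ≡ (∂₂v)₁`), then every slice is invariant under vertical translations
(`translate_eq_of_vertRigid`), so the ancient planar Liouville theorem with the Type-I rate (N₁, tree
`eq_zero_of_translate_eq`) gives `v ≡ 0` (port of nsreg-p1 Sketch8A `poloidalRigidity_rung_vertRigid`). -/
theorem eq_zero_of_vertRigid (hrate : HasTypeITimeDecay C v)
    (hcont : ContinuousOn (uncurry v) (Iio (0 : ℝ) ×ˢ univ))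
    (hmild : ∀ s t : ℝ, s < t → t < 0 → ∀ x,
      v t x = UnboundedOperators.heatExtension (v s) (t - s) x - oseenDuhamel 1 s v v t x)
    (hdiv : ∀ t < 0, VectorCalculus.IsDivFree (v t))
    (h0 : ∀ s < 0, ∀ y, fderiv ℝ (v s) y (EuclideanSpace.single 2 1) 0 = 0)
    (h1 : ∀ s < 0, ∀ y, fderiv ℝ (v s) y (EuclideanSpace.single 2 1) 1 = 0) : ∀ t < 0, ∀ x, v t x = 0 := by
  have hinv : ∀ s < 0, ∀ (y : EuclideanSpace ℝ (Fin 3)) (l : ℝ),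
      v s (y + l • (EuclideanSpace.single 2 1 : EuclideanSpace ℝ (Fin 3))) = v s y := by
    intro s hs y l
    have hC2 : ContDiff ℝ 2 (v s) := (analyticOnNhd_slice hcont (bdd_of_hasTypeITimeDecay hrate) hmild hs).contDiff
    exact translate_eq_of_vertRigid hC2 (hdiv s hs) (fun y => hrate s hs y) (h0 s hs) (h1 s hs) y l
  have hne : (EuclideanSpace.single 2 1 : EuclideanSpace ℝ (Fin 3)) ≠ 0 := fun h => by
    simpa using congrArg (fun w : EuclideanSpace ℝ (Fin 3) => w 2) h
  exact eq_zero_of_translate_eq hrate hcont hmild hdiv hne hinv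

/-- **(R8-f) The vertically rigid sub-stratum of the open stub is settled**: such a profile is not backward-singular
(it vanishes). -/
theorem nonflatLiouville_of_vertRigid (hrate : HasTypeITimeDecay C v)
    (hcont : ContinuousOn (uncurry v) (Iio (0 : ℝ) ×ˢ univ))
    (hmild : ∀ s t : ℝ, s < t → t < 0 → ∀ x,
      v t x = UnboundedOperators.heatExtension (v s) (t - s) x - oseenDuhamel 1 s v v t x)
    (hdiv : ∀ t < 0, VectorCalculus.IsDivFree (v t))
    (h0 : ∀ s < 0, ∀ y, fderiv ℝ (v s) y (EuclideanSpace.single 2 1) 0 = 0)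
    (h1 : ∀ s < 0, ∀ y, fderiv ℝ (v s) y (EuclideanSpace.single 2 1) 1 = 0) : ¬ IsBackwardSingularPoint v 0 :=
  not_backwardSingular_of_zero (eq_zero_of_vertRigid hrate hcont hmild hdiv h0 h1)

end Summit.NavierStokesRegularity.NavierStokesRegularity.Theorems.PoloidalWindowDoorPoloidalWindowRigidityDegenerate

end
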